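import Summits.QuantumFields.YangMills.Theorems.BalabanUVNodesN15TwoGridMeanZeroMultiplierSup
import Summits.QuantumFields.YangMills.Theorems.BalabanUVNodesN15KingModelDressedJetNoFit
import Summits.QuantumFields.YangMills.Theorems.BalabanUVNodesN15TwoGridEntry1
import HarnessLib

/-!
# N15 (NE2) — PROGRAMME K, part K-J: ★★★ THE η-DEFECT OF THE WHOLE FIRST-ORDER DRESSED JET — VALUE AND GRADIENT — OF BAŁABAN's LANDAU-GAUGE PAIR `(Δ′_a⁻¹, Δ_a⁻¹)` UNDER THE (3.35) PAIR ALONE,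
# SUP-BLOCK CURRENCY, HYPOTHESIS-FREE: III-B ★★★ `hasMaj_idef_bgPair_of_sandwichRows` FIRED ON THE PAIR OF RECORD (its ninth row = K-I ★★★; no letter on `∇c′`, no fit of `c′`, no level decomposition)

WHO ∕ WHEN.  Cell `pub-ymgap`, seat `pub-ymgap-dag-n15-a` (KNIT-BY-NAME seat of Track-A DAG node N15 = NE2, g25); `--kind proof --supports stmt-QuantumFields-27366 --as helper` (K3⁸;
count-neutral).  THEOREMS ONLY (0 `def`).  Over III-B `…TwoGridDressedJetNoFitC` (★★★ `hasMaj_idef_bgPair_of_sandwichRows`, ★★ `hasMaj_projO_idef_bgPair`), K-I `…TwoGridMeanZeroMultiplierSup`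
(★★★ `hasMaj_gGrad_comp_idef_mulOp_blockAvg`), M-C ★★★ `hasMaj_comp_idef_mulOp_blockAvg_of_divAdj`, parts 42 (`ineq110_114_pair`, `hasMaj_gOp∕grad∕gDivAdj_of_ineq`), 52 (`hasMaj_twoGridDefect`),
59 (`hasMaj_twoGridDefect_grad`), K-B (`jetKing_const_bound`, arithmetic only), `B6UnitTorusCarrier.rowSum_unitTorusGeo` BY NAME; nothing in the tree is modified.

WHY.  HANDOFF §g24.3 (v) ∕ (S3): the dressed GRADIENT entry of the pair of record under (3.35)-letters needed ONE missing row — the `c′`-defect under the fronts `∇′_νG′` — located as «level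
decomposition ∕ kernel profiles of `Δ_a⁻¹`».  K-E found it in L²-block currency (Bałaban's (1.114) «∇G∇*»), K-I upgraded it to the sup entry by sub-box interpolation with the (1.111) Hölder
steps.  With it, III-B runs for the pair of record exactly as K-B ran for King's model: every row a LANDED theorem, the `c′`-defect sandwiched (M-C under `G′`, K-I under `∇′G′`), NO letter on `∇c′`.

WHAT.  §14 ★★★ `hasMaj_idef_bgPair_gOp (hLodd : Odd L) (hL3 : 3 ≤ L) (ha : 0 < a) : ∃ δ r₀ B > 0, ∀ m_T k m (1 ≤ k) (hL) (r ∈ [0, r₀]) (o_a ≥ 0) (c′ a′) (|c′|, |a′_μ| ≤ r) (|a′_μ − ā_μ∘kingPrV| ≤ o_a):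
HasMaj (ofBlocks (unitTorusGeo L k M) (blkFine L k M)) (ofBlocks (unitTorusGeo L k M) (blkPair (blockOf (L^m·L^k) M ∘ fst)))
(idef (pull kingPrV) (pull (liftPair kingPrV)) (bgPair Δ′_a⁻¹ (ρ′(sD′_μ)∘Δ′_a⁻¹)_μ c′ a′) (bgPair Δ_a⁻¹ (ρ(sD_μ)∘Δ_a⁻¹)_μ c̄ ā)) (B((L^k)^{−1∕16} + r(L^k)^{−1∕(8(d+1))} + o_a)e^{−δd})`,
`M = MP (paramsOf d L m_T k hL)` — HYPOTHESIS-FREE; ★★ `hasMaj_projO_idef_bgPair_gOp` (every component — `some ν` = THE DRESSED GRADIENT ENTRY OF THE PAIR OF RECORD, `none` = the value entry).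

HONEST FRAMING ∕ LIMITS.  `U ≡ 1` Landau-gauge pair on the torus family of record (b05 model of [B5] (1.69)–(1.71)); abelianised scalar-multiplier MODEL of (3.52)'s `V′(A)`, block-averaged coarse
partner (C3); letters on `(c′, a′)` = sups + ONE fit of `a′`; rate exponents `1∕16`, `1∕(8(d+1))` are currency artefacts (parts 59∕71's interpolations); the NE2 packaging by name is the sequel
K-K.  NE2⁺ NOT printed ∕ NOT proved; no statement of record touched; N15 NOT discharged; K3⁸ OPEN; counts UNMOVED (typed 28∕28 · discharged 5∕27); one finite torus per index — NOT ℝ⁴ ∕ infinite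
volume ∕ OS ∕ mass gap ∕ Clay.  ONE declared `set_option maxHeartbeats 800000 in` on ★★★.
-/

noncomputable section

open scoped BigOperators
open Finset

namespace Summit.QuantumFields.YangMills.BalabanUVNodes.N15.TwoGrid

open Literature.MathematicalPhysics.QuantumFieldTheory.Balaban1983to89
open Literature.MathematicalPhysics.QuantumFieldTheory.Balaban1983to89.B11SectG (BlockNorm HasMaj)
open Literature.MathematicalPhysics.QuantumFieldTheory.Balaban1983to89.T4EtaRateDefect (idef)
open Literature.MathematicalPhysics.QuantumFieldTheory.Balaban1983to89.T4EtaRateCoeffDefect (pull blockAvg)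
open Literature.MathematicalPhysics.QuantumFieldTheory.Balaban1983to89.B6Prop26Gluing (mulOp)
open Literature.MathematicalPhysics.QuantumFieldTheory.Balaban1983to89.B5Prop11Plancherel (Tor fine unitVec)
open Literature.MathematicalPhysics.QuantumFieldTheory.Balaban1983to89.B5SiteBridgeP12 (MP)
open Literature.MathematicalPhysics.QuantumFieldTheory.King1986.Torus (blockOf tdistT tdistT_nonneg)
open Literature.MathematicalPhysics.QuantumFieldTheory.Balaban1983to89.B6UnitTorusCarrier (unitTorusGeo rowSum_unitTorusGeo)
open Summit.QuantumFields.YangMills.BalabanUVNodes.N15.VectorPiece (blkFine kingPrV)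
open Summit.QuantumFields.YangMills.BalabanUVNodes.N15.BackgroundLayer (bgPair projO liftPair blkPair)
open Summit.QuantumFields.YangMills.BalabanUVNodes.N15.TwoGrid.KingJet (jetKing_const_bound)

variable (d : ℕ) {L : ℕ} [NeZero L]

/-! ## §14 ★★★ III-B on the pair of record, sup currency -/

set_option maxHeartbeats 800000 in
/-- ★★★ **THE η-DEFECT OF THE WHOLE FIRST-ORDER DRESSED JET OF BAŁABAN's PAIR `(Δ′_a⁻¹, Δ_a⁻¹)`, SUP-BLOCK CURRENCY, HYPOTHESIS-FREE, NO LETTER ON `∇c′`, NO FIT OF `c′`.**  See the module docstring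
(WHAT).  Rows: (1.110) on both grids (part 42), the bare defects (parts 52 at `γ = ⅛` and 59), the `c′`-rows M-C (front `G′`, from (1.110) «G∇*») and K-I (fronts `∇′G′`); one common constant `β`,
`σ = ρ := δ∕2`, `B_X = 2β`, window `r₀ := (2β(d+2)c_r + 1)⁻¹`. [cite: Balaban1985BackgroundPropagators, (3.35) p.396, (3.52) p.400, (3.62)–(3.65) pp.402–403 (mechanism), Thm 3.1 (3.42) p.397 (entries
0–1: shape); Balaban1984PropagatorsI, Prop. 1.2 (1.110)–(1.111) pp.35, (1.114) p.36; King1986, p.664 (pairing), Prop. 3.9 (3.73) p.665 (rate factor); Balaban1984PropagatorsII, Lemma 2.1 (2.61) p.234] -/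
theorem hasMaj_idef_bgPair_gOp (hLodd : Odd L) (hL3 : 3 ≤ L) {a : ℝ} (ha : 0 < a) :
    ∃ δ r₀ B : ℝ, 0 < δ ∧ 0 < r₀ ∧ 0 < B ∧ ∀ (mT k m : ℕ) (hk : 1 ≤ k) (hL : Odd L ∧ 1 < L) (r : ℝ) (_hr : 0 ≤ r) (_hr₀ : r ≤ r₀) (oa : ℝ) (_hoa : 0 ≤ oa)
      (c' : Tor (fine (L ^ m * L ^ k) (MP (paramsOf d L mT k hL))) × Fin (d + 1) → ℝ) (a' : Fin (d + 1) → Tor (fine (L ^ m * L ^ k) (MP (paramsOf d L mT k hL))) × Fin (d + 1) → ℝ)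
      (_hc' : ∀ z, |c' z| ≤ r) (_ha' : ∀ μ z, |a' μ z| ≤ r)
      (_hfa : ∀ μ z, |a' μ z - blockAvg (kingPrV L k m (MP (paramsOf d L mT k hL))) (a' μ) (kingPrV L k m (MP (paramsOf d L mT k hL)) z)| ≤ oa),
      HasMaj (BlockNorm.ofBlocks (unitTorusGeo L k (MP (paramsOf d L mT k hL))) (blkFine L k (MP (paramsOf d L mT k hL))))
        (BlockNorm.ofBlocks (unitTorusGeo L k (MP (paramsOf d L mT k hL)))
          (blkPair (J := Fin (d + 1)) fun i : Tor (fine (L ^ m * L ^ k) (MP (paramsOf d L mT k hL))) × Fin (d + 1) => blockOf (L ^ m * L ^ k) (MP (paramsOf d L mT k hL)) i.1))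
        (idef (pull (kingPrV L k m (MP (paramsOf d L mT k hL)))) (pull (liftPair (J := Fin (d + 1)) (kingPrV L k m (MP (paramsOf d L mT k hL)))))
          (bgPair (gOp (MP (paramsOf d L mT k hL)) (L ^ m * L ^ k) a)
            (fun μ => symbOp (MP (paramsOf d L mT k hL)) (L ^ m * L ^ k) (sD (MP (paramsOf d L mT k hL)) (L ^ m * L ^ k) μ ((L ^ m * L ^ k : ℕ) : ℝ)) ∘ₗ
              gOp (MP (paramsOf d L mT k hL)) (L ^ m * L ^ k) a) c' a')
          (bgPair (gOp (MP (paramsOf d L mT k hL)) (L ^ k) a)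
            (fun μ => symbOp (MP (paramsOf d L mT k hL)) (L ^ k) (sD (MP (paramsOf d L mT k hL)) (L ^ k) μ ((L ^ k : ℕ) : ℝ)) ∘ₗ gOp (MP (paramsOf d L mT k hL)) (L ^ k) a)
            (blockAvg (kingPrV L k m (MP (paramsOf d L mT k hL))) c') (fun μ => blockAvg (kingPrV L k m (MP (paramsOf d L mT k hL))) (a' μ))))
        (fun y y' => B * (((L ^ k : ℕ) : ℝ) ^ (-(1 / 16 : ℝ)) + r * ((L ^ k : ℕ) : ℝ) ^ (-(1 / (8 * ((d : ℝ) + 1)))) + oa) *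
          Real.exp (-(δ * tdistT (MP (paramsOf d L mT k hL)) y y'))) := by
  have hL2 : 2 ≤ L := by omega
  have hL : Odd L ∧ 1 < L := ⟨hLodd, by omega⟩
  -- the letters of record
  obtain ⟨δ₀, C, Cα, Cε, Cαε, hδ₀, hC, H110⟩ := ineq110_114_pair (d := d) hL ha
  obtain ⟨δ₁, D₁, hδ₁, hD₁, HDef⟩ := hasMaj_twoGridDefect (d := d) hLodd hL2 ha (γ := 1 / 8) (by norm_num) (by norm_num)
  obtain ⟨δ₂, D₂, hδ₂, hD₂, HDef1⟩ := hasMaj_twoGridDefect_grad (d := d) hLodd hL2 ha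
  obtain ⟨δ₃, CI, hδ₃, hCI, HI⟩ := hasMaj_gGrad_comp_idef_mulOp_blockAvg d hLodd hL2 ha
  -- common rate and constant
  set δm : ℝ := min (min δ₀ δ₁) (min δ₂ δ₃) with hδm_def
  have hδm : 0 < δm := lt_min (lt_min hδ₀ hδ₁) (lt_min hδ₂ hδ₃)
  have eδ₀ : δm ≤ δ₀ := (min_le_left _ _).trans (min_le_left _ _)
  have eδ₁ : δm ≤ δ₁ := (min_le_left _ _).trans (min_le_right _ _)
  have eδ₂ : δm ≤ δ₂ := (min_le_right _ _).trans (min_le_left _ _)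
  have eδ₃ : δm ≤ δ₃ := (min_le_right _ _).trans (min_le_right _ _)
  set β : ℝ := C + D₁ + D₂ + 2 * ((d : ℝ) + 1) * C + CI with hβ_def
  have hβ : 0 < β := by positivity
  have bC : C ≤ β := by rw [hβ_def]; nlinarith [hD₁.le, hD₂.le, hCI.le, hC.le, (Nat.cast_nonneg d : (0:ℝ) ≤ d)]
  have bD₁ : D₁ ≤ β := by rw [hβ_def]; nlinarith [hD₂.le, hCI.le, hC.le, (Nat.cast_nonneg d : (0:ℝ) ≤ d)]
  have bD₂ : D₂ ≤ β := by rw [hβ_def]; nlinarith [hD₁.le, hCI.le, hC.le, (Nat.cast_nonneg d : (0:ℝ) ≤ d)]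
  have bCI : CI ≤ β := by rw [hβ_def]; nlinarith [hD₁.le, hD₂.le, hC.le, (Nat.cast_nonneg d : (0:ℝ) ≤ d)]
  have b2C : 2 * ((d : ℝ) + 1) * C ≤ β := by rw [hβ_def]; nlinarith [hD₁.le, hD₂.le, hCI.le, hC.le]
  have hσ : 0 < δm / 2 := by positivity
  set cr : ℝ := B4Sect5Proof.latticeConst (d + 1) (δm / 2) with hcr_def
  have hcr : 0 ≤ cr := B4Sect5Proof.latticeConst_nonneg (d + 1) hσ.le
  set W : ℝ := β * ((d : ℝ) + 2) * cr with hW_def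
  have hW : 0 ≤ W := by positivity
  have hr₀ : 0 < (2 * W + 1)⁻¹ := by positivity
  set r₀ : ℝ := (2 * W + 1)⁻¹ with hr₀_def
  refine ⟨δm / 2, r₀, 2 * β * cr + 4 * β ^ 2 * cr * r₀ * ((d : ℝ) + 2) + 16 * β ^ 2 * cr * ((d : ℝ) + 1) + 8 * β ^ 2 * cr + 1, hσ, hr₀, by positivity, ?_⟩
  intro mT k m hk hL' r hr hrr₀ oa hoa c' a' hc' ha' hfa
  have hLr : (0 : ℝ) < (L : ℝ) := by exact_mod_cast (show 0 < L by omega)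
  have hkpos : (0 : ℝ) < ((L ^ k : ℕ) : ℝ) := by positivity
  have hn : 1 ≤ L ^ k := Nat.one_le_pow _ _ (by omega)
  have hn' : 1 ≤ L ^ m * L ^ k := Nat.one_le_iff_ne_zero.mpr (NeZero.ne _)
  have hnr1 : (1 : ℝ) ≤ ((L ^ k : ℕ) : ℝ) := by exact_mod_cast hn
  have hθ : 0 ≤ ((L ^ k : ℕ) : ℝ) ^ (-(1 / 16 : ℝ)) := Real.rpow_nonneg hkpos.le _
  have hx : 0 ≤ (((L ^ k : ℕ) : ℝ))⁻¹ := inv_nonneg.mpr hkpos.le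
  have ht : 0 ≤ ((L ^ k : ℕ) : ℝ) ^ (-(1 / (8 * ((d : ℝ) + 1)))) := Real.rpow_nonneg hkpos.le _
  have hxt : (((L ^ k : ℕ) : ℝ))⁻¹ ≤ ((L ^ k : ℕ) : ℝ) ^ (-(1 / (8 * ((d : ℝ) + 1)))) := by
    rw [← Real.rpow_neg_one]
    exact Real.rpow_le_rpow_of_exponent_le hnr1 (by rw [neg_le_neg_iff, div_le_one (by positivity)]; have : (0:ℝ) ≤ d := Nat.cast_nonneg d; nlinarith)
  have hmono : ∀ {F₁ F₂ : Type} [AddCommGroup F₁] [Module ℝ F₁] [AddCommGroup F₂] [Module ℝ F₂]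
      {b₁ : BlockNorm (unitTorusGeo L k (MP (paramsOf d L mT k hL'))) F₁} {b₂ : BlockNorm (unitTorusGeo L k (MP (paramsOf d L mT k hL'))) F₂} {T : F₁ →ₗ[ℝ] F₂} {A A' tt : ℝ},
      0 ≤ A → A ≤ A' → δm ≤ tt → HasMaj b₁ b₂ T (fun y y' => A * Real.exp (-(tt * tdistT (MP (paramsOf d L mT k hL')) y y'))) →
      HasMaj b₁ b₂ T (fun y y' => A' * Real.exp (-(δm * tdistT (MP (paramsOf d L mT k hL')) y y'))) :=
    fun hA hAA' htt h => h.mono fun y y' => mul_le_mul hAA' (Real.exp_le_exp.mpr (by nlinarith [tdistT_nonneg (MP (paramsOf d L mT k hL')) y y'])) (Real.exp_nonneg _) (hA.trans hAA')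
  -- (1.110) rows at the common constant
  obtain ⟨Hc, Hf⟩ := H110 mT k m hk
  have hG := hmono hC.le bC eδ₀ (hasMaj_gOp_of_ineq (MP (paramsOf d L mT k hL')) k (L ^ k) a hn Hc hC.le)
  have hGD := fun μ : Fin (d + 1) => hmono hC.le bC eδ₀ (hasMaj_grad_of_ineq (MP (paramsOf d L mT k hL')) k (L ^ k) a hn Hc hC.le μ)
  have hG' := hmono hC.le bC eδ₀ (hasMaj_gOp_of_ineq (MP (paramsOf d L mT k hL')) k (L ^ m * L ^ k) a hn' Hf hC.le)
  have hG'D := fun μ : Fin (d + 1) => hmono hC.le bC eδ₀ (hasMaj_grad_of_ineq (MP (paramsOf d L mT k hL')) k (L ^ m * L ^ k) a hn' Hf hC.le μ)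
  have hG'div := fun κ : Fin (d + 1) => hmono hC.le le_rfl eδ₀ (hasMaj_gDivAdj_of_ineq (MP (paramsOf d L mT k hL')) k (L ^ m * L ^ k) a hn' Hf hC.le κ)
  -- the bare defects at `m_G := β·(L^k)^{−1∕16}`
  have hγ8 : (-((1 / 8 : ℝ) / 2)) = -(1 / 16 : ℝ) := by norm_num
  have hDG₀ := HDef mT k m hk hL'
  rw [hγ8] at hDG₀
  have hDG := hmono (A := D₁ * ((L ^ k : ℕ) : ℝ) ^ (-(1 / 16 : ℝ))) (A' := β * ((L ^ k : ℕ) : ℝ) ^ (-(1 / 16 : ℝ))) (by positivity) (mul_le_mul_of_nonneg_right bD₁ hθ) eδ₁ hDG₀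
  have hDD := fun μ : Fin (d + 1) => hmono (A := D₂ * ((L ^ k : ℕ) : ℝ) ^ (-(1 / 16 : ℝ))) (A' := β * ((L ^ k : ℕ) : ℝ) ^ (-(1 / 16 : ℝ))) (by positivity)
    (mul_le_mul_of_nonneg_right bD₂ hθ) eδ₂ (HDef1 mT k m hk hL' μ)
  -- the `c′`-rows: front `G′` (M-C, sup) and fronts `∇′G′` (K-I, sup)
  have hGc₀ := hasMaj_comp_idef_mulOp_blockAvg_of_divAdj (MP (paramsOf d L mT k hL')) k m (fun y y' => mul_nonneg hC.le (Real.exp_nonneg _)) hr hc' hG'div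
  have hGc : HasMaj (BlockNorm.ofBlocks (unitTorusGeo L k (MP (paramsOf d L mT k hL'))) (blkFine L k (MP (paramsOf d L mT k hL'))))
      (BlockNorm.ofBlocks (unitTorusGeo L k (MP (paramsOf d L mT k hL'))) (fun i : Tor (fine (L ^ m * L ^ k) (MP (paramsOf d L mT k hL'))) × Fin (d + 1) => blockOf (L ^ m * L ^ k) (MP (paramsOf d L mT k hL')) i.1))
      (gOp (MP (paramsOf d L mT k hL')) (L ^ m * L ^ k) a ∘ₗ idef (pull (kingPrV L k m (MP (paramsOf d L mT k hL')))) (pull (kingPrV L k m (MP (paramsOf d L mT k hL'))))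
        (mulOp c') (mulOp (blockAvg (kingPrV L k m (MP (paramsOf d L mT k hL'))) c')))
      (fun y y' => β * r * (((L ^ k : ℕ) : ℝ))⁻¹ * Real.exp (-(δm * tdistT (MP (paramsOf d L mT k hL')) y y'))) := by
    refine hGc₀.mono fun y y' => ?_
    have hE := Real.exp_nonneg (-(δm * tdistT (MP (paramsOf d L mT k hL')) y y'))
    calc 2 * (d + 1) * r * (((L ^ k : ℕ) : ℝ))⁻¹ * (C * Real.exp (-(δm * tdistT (MP (paramsOf d L mT k hL')) y y')))
        = (2 * ((d : ℝ) + 1) * C) * r * (((L ^ k : ℕ) : ℝ))⁻¹ * Real.exp (-(δm * tdistT (MP (paramsOf d L mT k hL')) y y')) := by ring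
      _ ≤ β * r * (((L ^ k : ℕ) : ℝ))⁻¹ * Real.exp (-(δm * tdistT (MP (paramsOf d L mT k hL')) y y')) :=
          mul_le_mul_of_nonneg_right (mul_le_mul_of_nonneg_right (mul_le_mul_of_nonneg_right b2C hr) hx) hE
  have hDGc := fun ν : Fin (d + 1) => hmono (A := CI * r * ((L ^ k : ℕ) : ℝ) ^ (-(1 / (8 * ((d : ℝ) + 1))))) (A' := β * r * ((L ^ k : ℕ) : ℝ) ^ (-(1 / (8 * ((d : ℝ) + 1)))))
    (by positivity) (mul_le_mul_of_nonneg_right (mul_le_mul_of_nonneg_right bCI hr) ht) eδ₃ (HI mT k m hk hL' ν c' r hr hc')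
  -- the two guards
  have h1 : r₀ * (2 * W + 1) = 1 := inv_mul_cancel₀ (by positivity)
  have hr₀W : r₀ * W ≤ 1 / 2 := by nlinarith [hr₀.le]
  have hqle : β * (r * ((d : ℝ) + 2)) * cr ≤ r₀ * W := by
    calc β * (r * ((d : ℝ) + 2)) * cr = r * (β * ((d : ℝ) + 2) * cr) := by ring
      _ ≤ r₀ * (β * ((d : ℝ) + 2) * cr) := mul_le_mul_of_nonneg_right hrr₀ (by positivity)
      _ = r₀ * W := by rw [hW_def]
  have hq : β * (r * ((d : ℝ) + 2)) * cr < 1 := by linarith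
  have hq0 : 0 ≤ (1 - β * (r * ((d : ℝ) + 2)) * cr)⁻¹ := inv_nonneg.mpr (by linarith)
  have hq2 : (1 - β * (r * ((d : ℝ) + 2)) * cr)⁻¹ ≤ 2 := by
    calc (1 - β * (r * ((d : ℝ) + 2)) * cr)⁻¹ ≤ (1 / 2)⁻¹ := inv_anti₀ (by norm_num) (by linarith)
      _ = 2 := by norm_num
  have hBX : β * (1 - β * (r * ((d : ℝ) + 2)) * cr)⁻¹ ≤ 2 * β := by nlinarith [mul_le_mul_of_nonneg_left hq2 hβ.le]
  have hq0' : 0 ≤ (1 - 1 * (β * (r * ((d : ℝ) + 2)) * cr))⁻¹ := by rw [one_mul]; exact hq0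
  have hq2' : (1 - 1 * (β * (r * ((d : ℝ) + 2)) * cr))⁻¹ ≤ 2 := by rw [one_mul]; exact hq2
  -- III-B
  have key := hasMaj_idef_bgPair_of_sandwichRows (MP (paramsOf d L mT k hL')) k m hσ.le hcr (rowSum_unitTorusGeo L k (MP (paramsOf d L mT k hL')) hσ)
    (ρ := δm / 2) (δ := δm) hσ.le (by linarith) hβ.le (mul_nonneg hβ.le hθ) hr hoa (mul_nonneg (mul_nonneg hβ.le hr) hx) (mul_nonneg (mul_nonneg hβ.le hr) ht) (BX := 2 * β)
    hG hGD hG' hG'D hDG hDD hGc hDGc hc' ha' hfa hq hBX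
  have hbd := jetKing_const_bound (s := (d : ℝ)) hβ.le hcr hθ hr hrr₀ hx hxt hoa (Nat.cast_nonneg d) hq0 hq2 hq0' hq2'
  refine key.mono fun y y' => ?_
  have hE := Real.exp_nonneg (-(δm / 2 * tdistT (MP (paramsOf d L mT k hL')) y y'))
  exact mul_le_mul_of_nonneg_right hbd hE

/-- ★★ **EVERY COMPONENT — IN PARTICULAR THE DRESSED GRADIENT ENTRY `𝔇(∇′_νX′, ∇_νX̄)` (`j = some ν`) AND THE VALUE ENTRY (`j = none`) OF THE PAIR OF RECORD — SUP-BLOCK CURRENCY,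
HYPOTHESIS-FREE** (III-B ★★ `hasMaj_projO_idef_bgPair`). [cite: Balaban1985BackgroundPropagators, Thm 3.1 (3.42) p.397 (entries 0 and 1: shape), (3.62)–(3.65) pp.402–403 (mechanism); Balaban1984PropagatorsI,
Prop. 1.2 (1.110)–(1.111) pp.35, (1.114) p.36] -/
theorem hasMaj_projO_idef_bgPair_gOp (hLodd : Odd L) (hL3 : 3 ≤ L) {a : ℝ} (ha : 0 < a) :
    ∃ δ r₀ B : ℝ, 0 < δ ∧ 0 < r₀ ∧ 0 < B ∧ ∀ (mT k m : ℕ) (hk : 1 ≤ k) (hL : Odd L ∧ 1 < L) (r : ℝ) (_hr : 0 ≤ r) (_hr₀ : r ≤ r₀) (oa : ℝ) (_hoa : 0 ≤ oa)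
      (c' : Tor (fine (L ^ m * L ^ k) (MP (paramsOf d L mT k hL))) × Fin (d + 1) → ℝ) (a' : Fin (d + 1) → Tor (fine (L ^ m * L ^ k) (MP (paramsOf d L mT k hL))) × Fin (d + 1) → ℝ)
      (_hc' : ∀ z, |c' z| ≤ r) (_ha' : ∀ μ z, |a' μ z| ≤ r)
      (_hfa : ∀ μ z, |a' μ z - blockAvg (kingPrV L k m (MP (paramsOf d L mT k hL))) (a' μ) (kingPrV L k m (MP (paramsOf d L mT k hL)) z)| ≤ oa) (j : Option (Fin (d + 1))),
      HasMaj (BlockNorm.ofBlocks (unitTorusGeo L k (MP (paramsOf d L mT k hL))) (blkFine L k (MP (paramsOf d L mT k hL))))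
        (BlockNorm.ofBlocks (unitTorusGeo L k (MP (paramsOf d L mT k hL)))
          (fun i : Tor (fine (L ^ m * L ^ k) (MP (paramsOf d L mT k hL))) × Fin (d + 1) => blockOf (L ^ m * L ^ k) (MP (paramsOf d L mT k hL)) i.1))
        (idef (pull (kingPrV L k m (MP (paramsOf d L mT k hL)))) (pull (kingPrV L k m (MP (paramsOf d L mT k hL))))
          (projO j ∘ₗ bgPair (gOp (MP (paramsOf d L mT k hL)) (L ^ m * L ^ k) a)
            (fun μ => symbOp (MP (paramsOf d L mT k hL)) (L ^ m * L ^ k) (sD (MP (paramsOf d L mT k hL)) (L ^ m * L ^ k) μ ((L ^ m * L ^ k : ℕ) : ℝ)) ∘ₗ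
              gOp (MP (paramsOf d L mT k hL)) (L ^ m * L ^ k) a) c' a')
          (projO j ∘ₗ bgPair (gOp (MP (paramsOf d L mT k hL)) (L ^ k) a)
            (fun μ => symbOp (MP (paramsOf d L mT k hL)) (L ^ k) (sD (MP (paramsOf d L mT k hL)) (L ^ k) μ ((L ^ k : ℕ) : ℝ)) ∘ₗ gOp (MP (paramsOf d L mT k hL)) (L ^ k) a)
            (blockAvg (kingPrV L k m (MP (paramsOf d L mT k hL))) c') (fun μ => blockAvg (kingPrV L k m (MP (paramsOf d L mT k hL))) (a' μ))))
        (fun y y' => B * (((L ^ k : ℕ) : ℝ) ^ (-(1 / 16 : ℝ)) + r * ((L ^ k : ℕ) : ℝ) ^ (-(1 / (8 * ((d : ℝ) + 1)))) + oa) *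
          Real.exp (-(δ * tdistT (MP (paramsOf d L mT k hL)) y y'))) := by
  obtain ⟨δ, r₀, B, hδ, hr₀, hB, H⟩ := hasMaj_idef_bgPair_gOp d hLodd hL3 ha
  refine ⟨δ, r₀, B, hδ, hr₀, hB, fun mT k m hk hL r hr hrr₀ oa hoa c' a' hc' ha' hfa j => ?_⟩
  exact (BackgroundLayer.hasMaj_projO_comp (g := unitTorusGeo L k (MP (paramsOf d L mT k hL))) _ (H mT k m hk hL r hr hrr₀ oa hoa c' a' hc' ha' hfa) j).congr
    fun v => funext fun x' => rfl

end Summit.QuantumFields.YangMills.BalabanUVNodes.N15.TwoGrid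

end
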